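import Summits.CriticalPhenomena.PercolationContinuityZ3.Theorems.PercNearOneGluingNoHeavyLowerTailFrontierDecRowsCutSetup
import Summits.CriticalPhenomena.PercolationContinuityZ3.Theorems.PercNearOneGluingNoHeavyLowerTailFrontierDecRowsRow37ThreeOneCutAIneq
import Summits.CriticalPhenomena.PercolationContinuityZ3.Theorems.PercNearOneGluingNoHeavyLowerTailFrontierDecRowsCutMeasure
import Summits.CriticalPhenomena.PercolationContinuityZ3.Theorems.PercNearOneGluingNoHeavyLowerTailFrontierDecRowsConeImplied
import HarnessLib

/-!
# Frontier dec row 37 `E₃(D[ab|c], D[ac|y], D[ay|b])` across a cut vertex isolating its HUB terminal `a`: an exact eight-row identity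

Support file for crux `stmt-CriticalPhenomena-4575` (four-point decreasing `E₃` frontier; row 37 is one of the four independent open rows),
seat `prim-l12-p6` gen 16; memo `run/shared/lean/prim/prim-l12/FROM-prim-l12-p6-g16-ROW37-HUB-IDENTITY.md` §1.  No definitions, no named facts, no sorries.

Gen 15 (memo `…g15-ROW44-CUT-VERTICES.md` §8.1) found that the `ρ²(1−ρ)` Bernstein coefficient of row 37 along the pendant pencil of its hub
terminal is NOT in the cone of Harris + the 38 proved frontier rows + row 37 itself ("located obstruction `P₂(37)`").  This file identifies it:
with `ρ = P(h ↔ a on the far side)` and the near-side events `Ebc = {b≁c}`, `Ecy = {c≁y}`, `Eby = {b≁y}`, `Hc = {c ↔ h}`, `Hy = {y ↔ h}`, `Hb = {b ↔ h}`,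
the glued events are `D[ab|c] = Ebc ∖ (Hc ∧ A)`, `D[ac|y] = Ecy ∖ (Hy ∧ A)`, `D[ay|b] = Eby ∖ (Hb ∧ A)`; on the pairwise intersections the
`H`-events are pairwise disjoint, every joint probability is affine in `ρ`, and EXACTLY (symbolic identity over the 15 cells of the near-side law)
  **`E₃(row 37 at (a,b,c,y)) = (1−ρ)³·row 43 at (b,c,y,·) + ρ(1−ρ)²·[row 19 at (b,h,c,y) + row 19 at (c,h,y,b) + row 19 at (y,h,b,c)]`**
  **`        + ρ²(1−ρ)·[row 15 at (h,b,c,y) + row 15 at (h,c,y,b) + row 15 at (h,y,b,c)] + ρ³·row 37 at (h,b,c,y)`**.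
Rows 43 (3PT-LB) and 19 are kernel theorems for every `n` (`frontier_43_all`, `frontier_19_all`); ROW 15 IS OPEN, so it enters as three hypotheses:
the obstruction `P₂(37)` is the `(b c y)`-symmetrised row 15 at `(h,·,·,·)`.
THEOREM (`sahiE3_row37_nonneg_of_threeOneCut_a`): `b, c, y` coloured `true`, `a` coloured `false`, every positive-weight edge avoiding `h` monochromatic;
row 15 at the three placements `(h,b,c,y)`, `(h,c,y,b)`, `(h,y,b,c)` and row 37 at `(h,b,c,y)` imply row 37 at `(a,b,c,y)`.
The row-15 analogue (a four-row identity with rows 43, 19, 19, 15) is `sahiE3_row15_nonneg_of_threeOneCut_a` (`…Row15ThreeOneCutA`, gen 15).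
-/

noncomputable section

namespace Summit.CriticalPhenomena.PercolationContinuityZ3.Theorems.FrontierDecRows

open MeasureTheory CovTransferCert E3GroupSepCert
open Literature.Probability.Percolation Literature.Probability.LatticeModels

variable {n : ℕ}

set_option maxHeartbeats 2400000 in
/-- **Row 37 across a cut vertex isolating the hub `a`, modulo row 15.**  `b, c, y` coloured `true`, `a` coloured `false`, every positive-weight
edge avoiding `h` monochromatic: row 15 at `(h,b,c,y)`, `(h,c,y,b)`, `(h,y,b,c)` and row 37 at `(h,b,c,y)` imply row 37 at `(a,b,c,y)`
(exact identity with rows 43, 19 ×3, 15 ×3, 37 and the `ρ`-weights `(1−ρ)³, ρ(1−ρ)², ρ²(1−ρ), ρ³`). [this work] -/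
theorem sahiE3_row37_nonneg_of_threeOneCut_a (w : Sym2 (Fin n) → unitInterval) (a b c y h : Fin n) (side : Fin n → Bool)
    (hb : side b = true) (hc : side c = true) (hy : side y = true) (ha : side a = false)
    (hw : ∀ u v : Fin n, u ≠ h → v ≠ h → side u ≠ side v → w s(u, v) = 0)
    (h15a : 0 ≤ sahiE3 (prodBernoulli w) (connEvent (row 15 n (h, b, c, y)).1) (connEvent (row 15 n (h, b, c, y)).2.1)
      (connEvent (row 15 n (h, b, c, y)).2.2))
    (h15b : 0 ≤ sahiE3 (prodBernoulli w) (connEvent (row 15 n (h, c, y, b)).1) (connEvent (row 15 n (h, c, y, b)).2.1)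
      (connEvent (row 15 n (h, c, y, b)).2.2))
    (h15c : 0 ≤ sahiE3 (prodBernoulli w) (connEvent (row 15 n (h, y, b, c)).1) (connEvent (row 15 n (h, y, b, c)).2.1)
      (connEvent (row 15 n (h, y, b, c)).2.2))
    (h37 : 0 ≤ sahiE3 (prodBernoulli w) (connEvent (row 37 n (h, b, c, y)).1) (connEvent (row 37 n (h, b, c, y)).2.1)
      (connEvent (row 37 n (h, b, c, y)).2.2)) :
    0 ≤ sahiE3 (prodBernoulli w) (connEvent (row 37 n (a, b, c, y)).1) (connEvent (row 37 n (a, b, c, y)).2.1)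
      (connEvent (row 37 n (a, b, c, y)).2.2) := by
  classical
  have h43 := frontier_43_all w b c y h
  have h19a := frontier_19_all w b h c y
  have h19b := frontier_19_all w c h y b
  have h19c := frontier_19_all w y h b c
  have hrow : row 37 n (a, b, c, y) = (sep [a, b] [c], sep [a, c] [y], sep [a, y] [b]) := rfl
  have hrow' : row 37 n (h, b, c, y) = (sep [h, b] [c], sep [h, c] [y], sep [h, y] [b]) := rfl
  have hrow15a : row 15 n (h, b, c, y) = (sep [h, b] [c], sep [h, c] [y], sep [b] [y]) := rfl
  have hrow15b : row 15 n (h, c, y, b) = (sep [h, c] [y], sep [h, y] [b], sep [c] [b]) := rfl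
  have hrow15c : row 15 n (h, y, b, c) = (sep [h, y] [b], sep [h, b] [c], sep [y] [c]) := rfl
  have hrow43 : row 43 n (b, c, y, h) = (sep [b] [c], sep [b] [y], sep [c] [y]) := rfl
  have hrow19a : row 19 n (b, h, c, y) = (sep [b, h] [c], sep [b] [y], sep [c] [y]) := rfl
  have hrow19b : row 19 n (c, h, y, b) = (sep [c, h] [y], sep [c] [b], sep [y] [b]) := rfl
  have hrow19c : row 19 n (y, h, b, c) = (sep [y, h] [b], sep [y] [c], sep [b] [c]) := rfl
  simp only [hrow, connEvent_sep]
  simp only [hrow', connEvent_sep] at h37; simp only [hrow43, connEvent_sep] at h43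
  simp only [hrow15a, connEvent_sep] at h15a; simp only [hrow15b, connEvent_sep] at h15b; simp only [hrow15c, connEvent_sep] at h15c
  simp only [hrow19a, connEvent_sep] at h19a; simp only [hrow19b, connEvent_sep] at h19b; simp only [hrow19c, connEvent_sep] at h19c
  set μ := prodBernoulli w with hμ
  have neA : ∀ x, side x = true → x ≠ a := fun x hx e => by rw [e, ha] at hx; exact Bool.false_ne_true hx
  obtain ⟨hba, hca, hya⟩ : b ≠ a ∧ c ≠ a ∧ y ≠ a := ⟨neA b hb, neA c hc, neA y hy⟩
  set F₁ : Finset (Sym2 (Fin n)) := Finset.univ.filter (fun e => ∀ u ∈ e, side u = true ∨ u = h) with hF₁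
  set F₂ : Finset (Sym2 (Fin n)) :=
    Finset.univ.filter (fun e => (∀ u ∈ e, side u = false ∨ u = h) ∧ ¬ ∀ u ∈ e, u = h) with hF₂
  have hdisj : Disjoint F₁ F₂ := cutSides_disjoint side h F₁ F₂ hF₁ hF₂
  set D : Finset (Sym2 (Fin n)) := F₁ ∪ F₂ with hD
  have hwD : ∀ e, e ∉ D → w e = 0 := fun e he => cutSides_weight_zero w side h F₁ F₂ hF₁ hF₂ hw e (by rwa [hD] at he)
  have pl : ∀ ω : Set (Sym2 (Fin n)), ∀ x z, side x = true → side z = true →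
      ((openGraph (ω ∩ ↑D)).Reachable x z ↔ (openGraph (ω ∩ ↑F₁)).Reachable x z) := by
    intro ω x z hx hz; rw [hD]; exact cutSides_reach_left side h F₁ F₂ hF₁ hF₂ ω x z hx hz
  have phl : ∀ ω : Set (Sym2 (Fin n)), ∀ x, side x = true →
      ((openGraph (ω ∩ ↑D)).Reachable h x ↔ (openGraph (ω ∩ ↑F₁)).Reachable h x) := by
    intro ω x hx; rw [hD, SimpleGraph.reachable_comm, cutSides_reach_h side h F₁ F₂ hF₁ hF₂ ω x hx, SimpleGraph.reachable_comm]
  have pc : ∀ ω : Set (Sym2 (Fin n)), ∀ x, side x = true → x ≠ a →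
      ((openGraph (ω ∩ ↑D)).Reachable a x ↔
        (openGraph (ω ∩ ↑F₁)).Reachable x h ∧ (openGraph (ω ∩ ↑F₂)).Reachable h a) := by
    intro ω x hx hxa; rw [hD]; exact cutSides_reach_cross side h F₁ F₂ hF₁ hF₂ ω x a hx ha hxa
  -- near-side events
  set Ebc : Set (Set (Sym2 (Fin n))) := {ω | ω ∩ ↑F₁ ∈ ((openConn b c)ᶜ : Set (Set (Sym2 (Fin n))))} with hEbc
  set Ecy : Set (Set (Sym2 (Fin n))) := {ω | ω ∩ ↑F₁ ∈ ((openConn c y)ᶜ : Set (Set (Sym2 (Fin n))))} with hEcy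
  set Eby : Set (Set (Sym2 (Fin n))) := {ω | ω ∩ ↑F₁ ∈ ((openConn b y)ᶜ : Set (Set (Sym2 (Fin n))))} with hEby
  set Hc : Set (Set (Sym2 (Fin n))) := {ω | ω ∩ ↑F₁ ∈ (openConn c h : Set (Set (Sym2 (Fin n))))} with hHc
  set Hy : Set (Set (Sym2 (Fin n))) := {ω | ω ∩ ↑F₁ ∈ (openConn y h : Set (Set (Sym2 (Fin n))))} with hHy
  set Hb : Set (Set (Sym2 (Fin n))) := {ω | ω ∩ ↑F₁ ∈ (openConn b h : Set (Set (Sym2 (Fin n))))} with hHb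
  set EA : Set (Set (Sym2 (Fin n))) := {ω | ω ∩ ↑F₂ ∈ (openConn h a : Set (Set (Sym2 (Fin n))))} with hEA
  set X : Set (Set (Sym2 (Fin n))) := {ω | ∀ x ∈ [a, b], ∀ z ∈ [c], ω ∉ openConn x z} with hX
  set Y : Set (Set (Sym2 (Fin n))) := {ω | ∀ x ∈ [a, c], ∀ z ∈ [y], ω ∉ openConn x z} with hY
  set Z : Set (Set (Sym2 (Fin n))) := {ω | ∀ x ∈ [a, y], ∀ z ∈ [b], ω ∉ openConn x z} with hZ
  have tX : {ω : Set (Sym2 (Fin n)) | ω ∩ ↑D ∈ X} = Ebc \ ((Ebc ∩ Hc) ∩ EA) := by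
    ext ω
    simp only [hX, hEbc, hHc, hEA, Set.mem_setOf_eq, Set.mem_sdiff, Set.mem_inter_iff, Set.mem_compl_iff, openConn, List.mem_cons,
      List.mem_nil_iff, or_false, forall_eq_or_imp, forall_eq]
    rw [pc ω c hc hca, pl ω b c hb hc]
    tauto
  have tY : {ω : Set (Sym2 (Fin n)) | ω ∩ ↑D ∈ Y} = Ecy \ ((Ecy ∩ Hy) ∩ EA) := by
    ext ω
    simp only [hY, hEcy, hHy, hEA, Set.mem_setOf_eq, Set.mem_sdiff, Set.mem_inter_iff, Set.mem_compl_iff, openConn, List.mem_cons,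
      List.mem_nil_iff, or_false, forall_eq_or_imp, forall_eq]
    rw [pc ω y hy hya, pl ω c y hc hy]
    tauto
  have tZ : {ω : Set (Sym2 (Fin n)) | ω ∩ ↑D ∈ Z} = Eby \ ((Eby ∩ Hb) ∩ EA) := by
    ext ω
    simp only [hZ, hEby, hHb, hEA, Set.mem_setOf_eq, Set.mem_sdiff, Set.mem_inter_iff, Set.mem_compl_iff, openConn, List.mem_cons,
      List.mem_nil_iff, or_false, forall_eq_or_imp, forall_eq]
    rw [pc ω b hb hba, pl ω y b hy hb, SimpleGraph.reachable_comm (u := y)]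
    tauto
  have tS : ∀ (x z : Fin n), side x = true → side z = true →
      {ω : Set (Sym2 (Fin n)) | ω ∩ ↑D ∈ {ω : Set (Sym2 (Fin n)) | ∀ p ∈ [x], ∀ q ∈ [z], ω ∉ openConn p q}} =
        {ω | ω ∩ ↑F₁ ∈ ((openConn x z)ᶜ : Set (Set (Sym2 (Fin n))))} := by
    intro x z hx hz; ext ω
    simp only [Set.mem_setOf_eq, List.mem_singleton, forall_eq, Set.mem_compl_iff, openConn]
    exact not_congr (pl ω x z hx hz)
  have tSh : ∀ (x z : Fin n), side x = true → side z = true →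
      {ω : Set (Sym2 (Fin n)) | ω ∩ ↑D ∈ {ω : Set (Sym2 (Fin n)) | ∀ p ∈ [x, h], ∀ q ∈ [z], ω ∉ openConn p q}} =
        {ω | ω ∩ ↑F₁ ∈ ((openConn x z)ᶜ : Set (Set (Sym2 (Fin n))))} ∩ {ω | ω ∩ ↑F₁ ∈ (openConn z h : Set (Set (Sym2 (Fin n))))}ᶜ := by
    intro x z hx hz; ext ω
    simp only [Set.mem_setOf_eq, Set.mem_inter_iff, Set.mem_compl_iff, openConn, List.mem_cons, List.mem_nil_iff, or_false,
      forall_eq_or_imp, forall_eq]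
    rw [pl ω x z hx hz, phl ω z hz, SimpleGraph.reachable_comm (u := h)]
  have tSh' : ∀ (x z : Fin n), side x = true → side z = true →
      {ω : Set (Sym2 (Fin n)) | ω ∩ ↑D ∈ {ω : Set (Sym2 (Fin n)) | ∀ p ∈ [h, x], ∀ q ∈ [z], ω ∉ openConn p q}} =
        {ω | ω ∩ ↑F₁ ∈ ((openConn x z)ᶜ : Set (Set (Sym2 (Fin n))))} ∩ {ω | ω ∩ ↑F₁ ∈ (openConn z h : Set (Set (Sym2 (Fin n))))}ᶜ := by
    intro x z hx hz; ext ω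
    simp only [Set.mem_setOf_eq, Set.mem_inter_iff, Set.mem_compl_iff, openConn, List.mem_cons, List.mem_nil_iff, or_false,
      forall_eq_or_imp, forall_eq]
    rw [pl ω x z hx hz, phl ω z hz, SimpleGraph.reachable_comm (u := h)]
    tauto
  have eCB : {ω : Set (Sym2 (Fin n)) | ω ∩ ↑F₁ ∈ ((openConn c b)ᶜ : Set (Set (Sym2 (Fin n))))} = Ebc := by
    ext ω; simp only [hEbc, Set.mem_setOf_eq, Set.mem_compl_iff, openConn]; rw [SimpleGraph.reachable_comm]
  have eYB : {ω : Set (Sym2 (Fin n)) | ω ∩ ↑F₁ ∈ ((openConn y b)ᶜ : Set (Set (Sym2 (Fin n))))} = Eby := by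
    ext ω; simp only [hEby, Set.mem_setOf_eq, Set.mem_compl_iff, openConn]; rw [SimpleGraph.reachable_comm]
  have eYC : {ω : Set (Sym2 (Fin n)) | ω ∩ ↑F₁ ∈ ((openConn y c)ᶜ : Set (Set (Sym2 (Fin n))))} = Ecy := by
    ext ω; simp only [hEcy, Set.mem_setOf_eq, Set.mem_compl_iff, openConn]; rw [SimpleGraph.reachable_comm]
  have thin : ∀ A : Set (Set (Sym2 (Fin n))), μ.real A = μ.real {ω | ω ∩ ↑D ∈ A} :=
    fun A => real_eq_real_setOf_inter_mem w D hwD A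
  have pre_inter : ∀ P Q : Set (Set (Sym2 (Fin n))),
      {ω : Set (Sym2 (Fin n)) | ω ∩ ↑D ∈ P ∩ Q} = {ω | ω ∩ ↑D ∈ P} ∩ {ω | ω ∩ ↑D ∈ Q} := fun P Q => rfl
  have ms : ∀ A : Set (Set (Sym2 (Fin n))), MeasurableSet A := fun A => (Set.toFinite _).measurableSet
  have detA : DeterminedBy EA (↑F₁ : Set (Sym2 (Fin n)))ᶜ := by
    rw [determinedBy_iff]
    intro ω ω' hω
    have hsub : (↑F₂ : Set (Sym2 (Fin n))) ⊆ (↑F₁ : Set (Sym2 (Fin n)))ᶜ := fun e he he1 =>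
      Finset.disjoint_left.1 hdisj (Finset.mem_coe.1 he1) (Finset.mem_coe.1 he)
    have : ω ∩ ↑F₂ = ω' ∩ ↑F₂ := by
      rw [← Set.inter_eq_self_of_subset_right hsub, ← Set.inter_assoc, ← Set.inter_assoc, hω]
    simp only [hEA, Set.mem_setOf_eq, this]
  have indep : ∀ S : Set (Set (Sym2 (Fin n))), (∃ P : Set (Set (Sym2 (Fin n))), S = {ω | ω ∩ ↑F₁ ∈ P}) →
      μ.real (S ∩ EA) = μ.real S * μ.real EA := by
    rintro S ⟨P, rfl⟩
    exact prodBernoulli_real_inter_of_determinedBy w F₁ ((determinedBy_iff _ _).2 fun ω ω' hω => by simp only [Set.mem_setOf_eq, hω])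
      detA (ms _) (ms _)
  -- pairwise disjointness of the `H` events on the separations
  have djCY : ∀ ω, ω ∈ Ecy → ω ∈ Hc → ω ∈ Hy → False := by
    intro ω h1 h2 h3
    simp only [hEcy, hHc, hHy, Set.mem_setOf_eq, Set.mem_compl_iff, openConn] at h1 h2 h3
    exact h1 (h2.trans h3.symm)
  have djBC : ∀ ω, ω ∈ Ebc → ω ∈ Hc → ω ∈ Hb → False := by
    intro ω h1 h2 h3
    simp only [hEbc, hHc, hHb, Set.mem_setOf_eq, Set.mem_compl_iff, openConn] at h1 h2 h3
    exact h1 (h3.trans h2.symm)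
  have djBY : ∀ ω, ω ∈ Eby → ω ∈ Hy → ω ∈ Hb → False := by
    intro ω h1 h2 h3
    simp only [hEby, hHy, hHb, Set.mem_setOf_eq, Set.mem_compl_iff, openConn] at h1 h2 h3
    exact h1 (h3.trans h2.symm)
  -- the seven glued probabilities
  have eX : μ.real X = μ.real Ebc - μ.real (Ebc ∩ Hc) * μ.real EA := by
    rw [thin, tX]; exact real_sdiff_block₁ μ ms Ebc Hc EA (indep _ ⟨(openConn b c)ᶜ ∩ openConn c h, rfl⟩)
  have eY : μ.real Y = μ.real Ecy - μ.real (Ecy ∩ Hy) * μ.real EA := by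
    rw [thin, tY]; exact real_sdiff_block₁ μ ms Ecy Hy EA (indep _ ⟨(openConn c y)ᶜ ∩ openConn y h, rfl⟩)
  have eZ : μ.real Z = μ.real Eby - μ.real (Eby ∩ Hb) * μ.real EA := by
    rw [thin, tZ]; exact real_sdiff_block₁ μ ms Eby Hb EA (indep _ ⟨(openConn b y)ᶜ ∩ openConn b h, rfl⟩)
  have eXY : μ.real (X ∩ Y) = μ.real (Ebc ∩ Ecy) - (μ.real (Ebc ∩ Ecy ∩ Hc) + μ.real (Ebc ∩ Ecy ∩ Hy)) * μ.real EA := by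
    rw [thin, pre_inter, tX, tY]
    have e : Ebc \ ((Ebc ∩ Hc) ∩ EA) ∩ (Ecy \ ((Ecy ∩ Hy) ∩ EA)) =
        (Ebc ∩ Ecy) \ ((((Ebc ∩ Ecy) ∩ Hc) ∪ ((Ebc ∩ Ecy) ∩ Hy)) ∩ EA) := by
      ext ω; simp only [Set.mem_sdiff, Set.mem_inter_iff, Set.mem_union]; tauto
    rw [e]; exact real_sdiff_block₂ μ ms (Ebc ∩ Ecy) Hc Hy EA (fun ω hω => djCY ω hω.2)
      (indep _ ⟨(openConn b c)ᶜ ∩ (openConn c y)ᶜ ∩ openConn c h, rfl⟩) (indep _ ⟨(openConn b c)ᶜ ∩ (openConn c y)ᶜ ∩ openConn y h, rfl⟩)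
  have eXZ : μ.real (X ∩ Z) = μ.real (Ebc ∩ Eby) - (μ.real (Ebc ∩ Eby ∩ Hc) + μ.real (Ebc ∩ Eby ∩ Hb)) * μ.real EA := by
    rw [thin, pre_inter, tX, tZ]
    have e : Ebc \ ((Ebc ∩ Hc) ∩ EA) ∩ (Eby \ ((Eby ∩ Hb) ∩ EA)) =
        (Ebc ∩ Eby) \ ((((Ebc ∩ Eby) ∩ Hc) ∪ ((Ebc ∩ Eby) ∩ Hb)) ∩ EA) := by
      ext ω; simp only [Set.mem_sdiff, Set.mem_inter_iff, Set.mem_union]; tauto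
    rw [e]; exact real_sdiff_block₂ μ ms (Ebc ∩ Eby) Hc Hb EA (fun ω hω => djBC ω hω.1)
      (indep _ ⟨(openConn b c)ᶜ ∩ (openConn b y)ᶜ ∩ openConn c h, rfl⟩) (indep _ ⟨(openConn b c)ᶜ ∩ (openConn b y)ᶜ ∩ openConn b h, rfl⟩)
  have eYZ : μ.real (Y ∩ Z) = μ.real (Ecy ∩ Eby) - (μ.real (Ecy ∩ Eby ∩ Hy) + μ.real (Ecy ∩ Eby ∩ Hb)) * μ.real EA := by
    rw [thin, pre_inter, tY, tZ]
    have e : Ecy \ ((Ecy ∩ Hy) ∩ EA) ∩ (Eby \ ((Eby ∩ Hb) ∩ EA)) =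
        (Ecy ∩ Eby) \ ((((Ecy ∩ Eby) ∩ Hy) ∪ ((Ecy ∩ Eby) ∩ Hb)) ∩ EA) := by
      ext ω; simp only [Set.mem_sdiff, Set.mem_inter_iff, Set.mem_union]; tauto
    rw [e]; exact real_sdiff_block₂ μ ms (Ecy ∩ Eby) Hy Hb EA (fun ω hω => djBY ω hω.2)
      (indep _ ⟨(openConn c y)ᶜ ∩ (openConn b y)ᶜ ∩ openConn y h, rfl⟩) (indep _ ⟨(openConn c y)ᶜ ∩ (openConn b y)ᶜ ∩ openConn b h, rfl⟩)
  have eXYZ : μ.real (X ∩ Y ∩ Z) = μ.real (Ebc ∩ Ecy ∩ Eby) -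
      (μ.real (Ebc ∩ Ecy ∩ Eby ∩ Hc) + μ.real (Ebc ∩ Ecy ∩ Eby ∩ Hy) + μ.real (Ebc ∩ Ecy ∩ Eby ∩ Hb)) * μ.real EA := by
    rw [thin, pre_inter, pre_inter, tX, tY, tZ]
    have e : Ebc \ ((Ebc ∩ Hc) ∩ EA) ∩ (Ecy \ ((Ecy ∩ Hy) ∩ EA)) ∩ (Eby \ ((Eby ∩ Hb) ∩ EA)) =
        (Ebc ∩ Ecy ∩ Eby) \ ((((Ebc ∩ Ecy ∩ Eby) ∩ Hc) ∪ ((Ebc ∩ Ecy ∩ Eby) ∩ Hy) ∪ ((Ebc ∩ Ecy ∩ Eby) ∩ Hb)) ∩ EA) := by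
      ext ω; simp only [Set.mem_sdiff, Set.mem_inter_iff, Set.mem_union]; tauto
    rw [e]
    exact real_sdiff_block₃ μ ms (Ebc ∩ Ecy ∩ Eby) Hc Hy Hb EA (fun ω hω => djCY ω hω.1.2) (fun ω hω => djBC ω hω.1.1)
      (fun ω hω => djBY ω hω.2) (indep _ ⟨(openConn b c)ᶜ ∩ (openConn c y)ᶜ ∩ (openConn b y)ᶜ ∩ openConn c h, rfl⟩)
      (indep _ ⟨(openConn b c)ᶜ ∩ (openConn c y)ᶜ ∩ (openConn b y)ᶜ ∩ openConn y h, rfl⟩)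
      (indep _ ⟨(openConn b c)ᶜ ∩ (openConn c y)ᶜ ∩ (openConn b y)ᶜ ∩ openConn b h, rfl⟩)
  have mC : ∀ S H : Set (Set (Sym2 (Fin n))), μ.real (S ∩ Hᶜ) = μ.real S - μ.real (S ∩ H) := real_inter_compl μ ms
  have m1 : ∀ P : Set (Set (Sym2 (Fin n))), ∀ S : Set (Set (Sym2 (Fin n))), {ω : Set (Sym2 (Fin n)) | ω ∩ ↑D ∈ P} = S → μ.real P = μ.real S := by
    intro P S hPS; rw [thin, hPS]
  -- hypothesis events, translated
  set Sbc : Set (Set (Sym2 (Fin n))) := {ω | ∀ p ∈ [b], ∀ q ∈ [c], ω ∉ openConn p q} with hSbc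
  set Scy : Set (Set (Sym2 (Fin n))) := {ω | ∀ p ∈ [c], ∀ q ∈ [y], ω ∉ openConn p q} with hScy
  set Sby : Set (Set (Sym2 (Fin n))) := {ω | ∀ p ∈ [b], ∀ q ∈ [y], ω ∉ openConn p q} with hSby
  set Scb : Set (Set (Sym2 (Fin n))) := {ω | ∀ p ∈ [c], ∀ q ∈ [b], ω ∉ openConn p q} with hScb
  set Syb : Set (Set (Sym2 (Fin n))) := {ω | ∀ p ∈ [y], ∀ q ∈ [b], ω ∉ openConn p q} with hSyb
  set Syc : Set (Set (Sym2 (Fin n))) := {ω | ∀ p ∈ [y], ∀ q ∈ [c], ω ∉ openConn p q} with hSyc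
  set Sbhc : Set (Set (Sym2 (Fin n))) := {ω | ∀ p ∈ [b, h], ∀ q ∈ [c], ω ∉ openConn p q} with hSbhc
  set Schy : Set (Set (Sym2 (Fin n))) := {ω | ∀ p ∈ [c, h], ∀ q ∈ [y], ω ∉ openConn p q} with hSchy
  set Syhb : Set (Set (Sym2 (Fin n))) := {ω | ∀ p ∈ [y, h], ∀ q ∈ [b], ω ∉ openConn p q} with hSyhb
  set Shbc : Set (Set (Sym2 (Fin n))) := {ω | ∀ p ∈ [h, b], ∀ q ∈ [c], ω ∉ openConn p q} with hShbc
  set Shcy : Set (Set (Sym2 (Fin n))) := {ω | ∀ p ∈ [h, c], ∀ q ∈ [y], ω ∉ openConn p q} with hShcy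
  set Shyb : Set (Set (Sym2 (Fin n))) := {ω | ∀ p ∈ [h, y], ∀ q ∈ [b], ω ∉ openConn p q} with hShyb
  have uBC : {ω : Set (Sym2 (Fin n)) | ω ∩ ↑D ∈ Sbc} = Ebc := by rw [hSbc, tS b c hb hc]
  have uCY : {ω : Set (Sym2 (Fin n)) | ω ∩ ↑D ∈ Scy} = Ecy := by rw [hScy, tS c y hc hy]
  have uBY : {ω : Set (Sym2 (Fin n)) | ω ∩ ↑D ∈ Sby} = Eby := by rw [hSby, tS b y hb hy]
  have uCB : {ω : Set (Sym2 (Fin n)) | ω ∩ ↑D ∈ Scb} = Ebc := by rw [hScb, tS c b hc hb, eCB]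
  have uYB : {ω : Set (Sym2 (Fin n)) | ω ∩ ↑D ∈ Syb} = Eby := by rw [hSyb, tS y b hy hb, eYB]
  have uYC : {ω : Set (Sym2 (Fin n)) | ω ∩ ↑D ∈ Syc} = Ecy := by rw [hSyc, tS y c hy hc, eYC]
  have uBHC : {ω : Set (Sym2 (Fin n)) | ω ∩ ↑D ∈ Sbhc} = Ebc ∩ Hcᶜ := by rw [hSbhc, tSh b c hb hc]
  have uCHY : {ω : Set (Sym2 (Fin n)) | ω ∩ ↑D ∈ Schy} = Ecy ∩ Hyᶜ := by rw [hSchy, tSh c y hc hy]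
  have uYHB : {ω : Set (Sym2 (Fin n)) | ω ∩ ↑D ∈ Syhb} = Eby ∩ Hbᶜ := by rw [hSyhb, tSh y b hy hb, eYB]
  have uHBC : {ω : Set (Sym2 (Fin n)) | ω ∩ ↑D ∈ Shbc} = Ebc ∩ Hcᶜ := by rw [hShbc, tSh' b c hb hc]
  have uHCY : {ω : Set (Sym2 (Fin n)) | ω ∩ ↑D ∈ Shcy} = Ecy ∩ Hyᶜ := by rw [hShcy, tSh' c y hc hy]
  have uHYB : {ω : Set (Sym2 (Fin n)) | ω ∩ ↑D ∈ Shyb} = Eby ∩ Hbᶜ := by rw [hShyb, tSh' y b hy hb, eYB]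
  rw [sahiE3_def] at h43 h19a h19b h19c h15a h15b h15c h37
  -- row 43 at (b,c,y,h): (Sbc, Sby, Scy)
  have v43_0 : μ.real (Sbc ∩ Sby ∩ Scy) = μ.real (Ebc ∩ Eby ∩ Ecy) := m1 _ _ (by rw [pre_inter, pre_inter, uBC, uBY, uCY])
  have v43_1 : μ.real Sbc = μ.real Ebc := m1 _ _ uBC
  have v43_2 : μ.real Sby = μ.real Eby := m1 _ _ uBY
  have v43_3 : μ.real Scy = μ.real Ecy := m1 _ _ uCY
  have v43_4 : μ.real (Sby ∩ Scy) = μ.real (Eby ∩ Ecy) := m1 _ _ (by rw [pre_inter, uBY, uCY])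
  have v43_5 : μ.real (Sbc ∩ Scy) = μ.real (Ebc ∩ Ecy) := m1 _ _ (by rw [pre_inter, uBC, uCY])
  have v43_6 : μ.real (Sbc ∩ Sby) = μ.real (Ebc ∩ Eby) := m1 _ _ (by rw [pre_inter, uBC, uBY])
  rw [v43_0, v43_1, v43_2, v43_3, v43_4, v43_5, v43_6] at h43
  -- row 19 at (b,h,c,y): (Sbhc, Sby, Scy)
  have v19a_0 : μ.real (Sbhc ∩ Sby ∩ Scy) = μ.real ((Ebc ∩ Hcᶜ) ∩ Eby ∩ Ecy) := m1 _ _ (by rw [pre_inter, pre_inter, uBHC, uBY, uCY])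
  have v19a_1 : μ.real Sbhc = μ.real (Ebc ∩ Hcᶜ) := m1 _ _ uBHC
  have v19a_5 : μ.real (Sbhc ∩ Scy) = μ.real ((Ebc ∩ Hcᶜ) ∩ Ecy) := m1 _ _ (by rw [pre_inter, uBHC, uCY])
  have v19a_6 : μ.real (Sbhc ∩ Sby) = μ.real ((Ebc ∩ Hcᶜ) ∩ Eby) := m1 _ _ (by rw [pre_inter, uBHC, uBY])
  rw [v19a_0, v19a_1, v43_2, v43_3, v43_4, v19a_5, v19a_6] at h19a
  -- row 19 at (c,h,y,b): (Schy, Scb, Syb)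
  have v19b_0 : μ.real (Schy ∩ Scb ∩ Syb) = μ.real ((Ecy ∩ Hyᶜ) ∩ Ebc ∩ Eby) := m1 _ _ (by rw [pre_inter, pre_inter, uCHY, uCB, uYB])
  have v19b_1 : μ.real Schy = μ.real (Ecy ∩ Hyᶜ) := m1 _ _ uCHY
  have v19b_2 : μ.real Scb = μ.real Ebc := m1 _ _ uCB
  have v19b_3 : μ.real Syb = μ.real Eby := m1 _ _ uYB
  have v19b_4 : μ.real (Scb ∩ Syb) = μ.real (Ebc ∩ Eby) := m1 _ _ (by rw [pre_inter, uCB, uYB])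
  have v19b_5 : μ.real (Schy ∩ Syb) = μ.real ((Ecy ∩ Hyᶜ) ∩ Eby) := m1 _ _ (by rw [pre_inter, uCHY, uYB])
  have v19b_6 : μ.real (Schy ∩ Scb) = μ.real ((Ecy ∩ Hyᶜ) ∩ Ebc) := m1 _ _ (by rw [pre_inter, uCHY, uCB])
  rw [v19b_0, v19b_1, v19b_2, v19b_3, v19b_4, v19b_5, v19b_6] at h19b
  -- row 19 at (y,h,b,c): (Syhb, Syc, Sbc)
  have v19c_0 : μ.real (Syhb ∩ Syc ∩ Sbc) = μ.real ((Eby ∩ Hbᶜ) ∩ Ecy ∩ Ebc) := m1 _ _ (by rw [pre_inter, pre_inter, uYHB, uYC, uBC])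
  have v19c_1 : μ.real Syhb = μ.real (Eby ∩ Hbᶜ) := m1 _ _ uYHB
  have v19c_2 : μ.real Syc = μ.real Ecy := m1 _ _ uYC
  have v19c_4 : μ.real (Syc ∩ Sbc) = μ.real (Ecy ∩ Ebc) := m1 _ _ (by rw [pre_inter, uYC, uBC])
  have v19c_5 : μ.real (Syhb ∩ Sbc) = μ.real ((Eby ∩ Hbᶜ) ∩ Ebc) := m1 _ _ (by rw [pre_inter, uYHB, uBC])
  have v19c_6 : μ.real (Syhb ∩ Syc) = μ.real ((Eby ∩ Hbᶜ) ∩ Ecy) := m1 _ _ (by rw [pre_inter, uYHB, uYC])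
  rw [v19c_0, v19c_1, v19c_2, v43_1, v19c_4, v19c_5, v19c_6] at h19c
  -- row 15 at (h,b,c,y): (Shbc, Shcy, Sby)
  have v15a_0 : μ.real (Shbc ∩ Shcy ∩ Sby) = μ.real ((Ebc ∩ Hcᶜ) ∩ (Ecy ∩ Hyᶜ) ∩ Eby) := m1 _ _ (by rw [pre_inter, pre_inter, uHBC, uHCY, uBY])
  have v15a_1 : μ.real Shbc = μ.real (Ebc ∩ Hcᶜ) := m1 _ _ uHBC
  have v15a_2 : μ.real Shcy = μ.real (Ecy ∩ Hyᶜ) := m1 _ _ uHCY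
  have v15a_4 : μ.real (Shcy ∩ Sby) = μ.real ((Ecy ∩ Hyᶜ) ∩ Eby) := m1 _ _ (by rw [pre_inter, uHCY, uBY])
  have v15a_5 : μ.real (Shbc ∩ Sby) = μ.real ((Ebc ∩ Hcᶜ) ∩ Eby) := m1 _ _ (by rw [pre_inter, uHBC, uBY])
  have v15a_6 : μ.real (Shbc ∩ Shcy) = μ.real ((Ebc ∩ Hcᶜ) ∩ (Ecy ∩ Hyᶜ)) := m1 _ _ (by rw [pre_inter, uHBC, uHCY])
  rw [v15a_0, v15a_1, v15a_2, v43_2, v15a_4, v15a_5, v15a_6] at h15a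
  -- row 15 at (h,c,y,b): (Shcy, Shyb, Scb)
  have v15b_0 : μ.real (Shcy ∩ Shyb ∩ Scb) = μ.real ((Ecy ∩ Hyᶜ) ∩ (Eby ∩ Hbᶜ) ∩ Ebc) := m1 _ _ (by rw [pre_inter, pre_inter, uHCY, uHYB, uCB])
  have v15b_2 : μ.real Shyb = μ.real (Eby ∩ Hbᶜ) := m1 _ _ uHYB
  have v15b_4 : μ.real (Shyb ∩ Scb) = μ.real ((Eby ∩ Hbᶜ) ∩ Ebc) := m1 _ _ (by rw [pre_inter, uHYB, uCB])
  have v15b_5 : μ.real (Shcy ∩ Scb) = μ.real ((Ecy ∩ Hyᶜ) ∩ Ebc) := m1 _ _ (by rw [pre_inter, uHCY, uCB])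
  have v15b_6 : μ.real (Shcy ∩ Shyb) = μ.real ((Ecy ∩ Hyᶜ) ∩ (Eby ∩ Hbᶜ)) := m1 _ _ (by rw [pre_inter, uHCY, uHYB])
  rw [v15b_0, v15a_2, v15b_2, v19b_2, v15b_4, v15b_5, v15b_6] at h15b
  -- row 15 at (h,y,b,c): (Shyb, Shbc, Syc)
  have v15c_0 : μ.real (Shyb ∩ Shbc ∩ Syc) = μ.real ((Eby ∩ Hbᶜ) ∩ (Ebc ∩ Hcᶜ) ∩ Ecy) := m1 _ _ (by rw [pre_inter, pre_inter, uHYB, uHBC, uYC])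
  have v15c_4 : μ.real (Shbc ∩ Syc) = μ.real ((Ebc ∩ Hcᶜ) ∩ Ecy) := m1 _ _ (by rw [pre_inter, uHBC, uYC])
  have v15c_5 : μ.real (Shyb ∩ Syc) = μ.real ((Eby ∩ Hbᶜ) ∩ Ecy) := m1 _ _ (by rw [pre_inter, uHYB, uYC])
  have v15c_6 : μ.real (Shyb ∩ Shbc) = μ.real ((Eby ∩ Hbᶜ) ∩ (Ebc ∩ Hcᶜ)) := m1 _ _ (by rw [pre_inter, uHYB, uHBC])
  rw [v15c_0, v15b_2, v15a_1, v19c_2, v15c_4, v15c_5, v15c_6] at h15c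
  -- row 37 at (h,b,c,y): (Shbc, Shcy, Shyb)
  have v37_0 : μ.real (Shbc ∩ Shcy ∩ Shyb) = μ.real ((Ebc ∩ Hcᶜ) ∩ (Ecy ∩ Hyᶜ) ∩ (Eby ∩ Hbᶜ)) := m1 _ _ (by rw [pre_inter, pre_inter, uHBC, uHCY, uHYB])
  have v37_4 : μ.real (Shcy ∩ Shyb) = μ.real ((Ecy ∩ Hyᶜ) ∩ (Eby ∩ Hbᶜ)) := m1 _ _ (by rw [pre_inter, uHCY, uHYB])
  have v37_5 : μ.real (Shbc ∩ Shyb) = μ.real ((Ebc ∩ Hcᶜ) ∩ (Eby ∩ Hbᶜ)) := m1 _ _ (by rw [pre_inter, uHBC, uHYB])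
  rw [v37_0, v15a_1, v15a_2, v15b_2, v37_4, v37_5, v15a_6] at h37
  -- singles and pairs with one complement
  have lA2 : μ.real (Ebc ∩ Hcᶜ) = μ.real Ebc - μ.real (Ebc ∩ Hc) := mC _ _
  have lB2 : μ.real (Ecy ∩ Hyᶜ) = μ.real Ecy - μ.real (Ecy ∩ Hy) := mC _ _
  have lG2 : μ.real (Eby ∩ Hbᶜ) = μ.real Eby - μ.real (Eby ∩ Hb) := mC _ _
  have pr : ∀ S H T : Set (Set (Sym2 (Fin n))), μ.real (S ∩ Hᶜ ∩ T) = μ.real (S ∩ T) - μ.real (S ∩ T ∩ H) := by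
    intro S H T
    have e : S ∩ Hᶜ ∩ T = (S ∩ T) ∩ Hᶜ := by ext ω; simp only [Set.mem_inter_iff, Set.mem_compl_iff]; tauto
    rw [e, mC]
  have lA3 : μ.real ((Ebc ∩ Hcᶜ) ∩ Ecy) = μ.real (Ebc ∩ Ecy) - μ.real (Ebc ∩ Ecy ∩ Hc) := pr _ _ _
  have lA4 : μ.real ((Ebc ∩ Hcᶜ) ∩ Eby) = μ.real (Ebc ∩ Eby) - μ.real (Ebc ∩ Eby ∩ Hc) := pr _ _ _
  have lB3 : μ.real ((Ecy ∩ Hyᶜ) ∩ Eby) = μ.real (Ecy ∩ Eby) - μ.real (Ecy ∩ Eby ∩ Hy) := pr _ _ _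
  have lB4 : μ.real ((Ecy ∩ Hyᶜ) ∩ Ebc) = μ.real (Ebc ∩ Ecy) - μ.real (Ebc ∩ Ecy ∩ Hy) := by
    have e : (Ecy ∩ Hyᶜ) ∩ Ebc = (Ebc ∩ Ecy) ∩ Hyᶜ := by ext ω; simp only [Set.mem_inter_iff, Set.mem_compl_iff]; tauto
    rw [e, mC]
  have lG3 : μ.real ((Eby ∩ Hbᶜ) ∩ Ebc) = μ.real (Ebc ∩ Eby) - μ.real (Ebc ∩ Eby ∩ Hb) := by
    have e : (Eby ∩ Hbᶜ) ∩ Ebc = (Ebc ∩ Eby) ∩ Hbᶜ := by ext ω; simp only [Set.mem_inter_iff, Set.mem_compl_iff]; tauto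
    rw [e, mC]
  have lG4 : μ.real ((Eby ∩ Hbᶜ) ∩ Ecy) = μ.real (Ecy ∩ Eby) - μ.real (Ecy ∩ Eby ∩ Hb) := by
    have e : (Eby ∩ Hbᶜ) ∩ Ecy = (Ecy ∩ Eby) ∩ Hbᶜ := by ext ω; simp only [Set.mem_inter_iff, Set.mem_compl_iff]; tauto
    rw [e, mC]
  -- triples with one complement
  have lA1 : μ.real ((Ebc ∩ Hcᶜ) ∩ Eby ∩ Ecy) = μ.real (Ebc ∩ Ecy ∩ Eby) - μ.real (Ebc ∩ Ecy ∩ Eby ∩ Hc) := by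
    have e : (Ebc ∩ Hcᶜ) ∩ Eby ∩ Ecy = (Ebc ∩ Ecy ∩ Eby) ∩ Hcᶜ := by ext ω; simp only [Set.mem_inter_iff, Set.mem_compl_iff]; tauto
    rw [e, mC]
  have lB1 : μ.real ((Ecy ∩ Hyᶜ) ∩ Ebc ∩ Eby) = μ.real (Ebc ∩ Ecy ∩ Eby) - μ.real (Ebc ∩ Ecy ∩ Eby ∩ Hy) := by
    have e : (Ecy ∩ Hyᶜ) ∩ Ebc ∩ Eby = (Ebc ∩ Ecy ∩ Eby) ∩ Hyᶜ := by ext ω; simp only [Set.mem_inter_iff, Set.mem_compl_iff]; tauto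
    rw [e, mC]
  have lG1 : μ.real ((Eby ∩ Hbᶜ) ∩ Ecy ∩ Ebc) = μ.real (Ebc ∩ Ecy ∩ Eby) - μ.real (Ebc ∩ Ecy ∩ Eby ∩ Hb) := by
    have e : (Eby ∩ Hbᶜ) ∩ Ecy ∩ Ebc = (Ebc ∩ Ecy ∩ Eby) ∩ Hbᶜ := by ext ω; simp only [Set.mem_inter_iff, Set.mem_compl_iff]; tauto
    rw [e, mC]
  -- pairs / triples with two or three complements
  have lC2 : μ.real ((Ebc ∩ Hcᶜ) ∩ (Ecy ∩ Hyᶜ)) = μ.real (Ebc ∩ Ecy) - (μ.real (Ebc ∩ Ecy ∩ Hc) + μ.real (Ebc ∩ Ecy ∩ Hy)) := by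
    have e : (Ebc ∩ Hcᶜ) ∩ (Ecy ∩ Hyᶜ) = (Ebc ∩ Ecy) ∩ Hcᶜ ∩ Hyᶜ := by ext ω; simp only [Set.mem_inter_iff, Set.mem_compl_iff]; tauto
    rw [e]; exact real_inter_compl₂ μ ms _ _ _ (fun ω hω => djCY ω hω.2)
  have lD2 : μ.real ((Ecy ∩ Hyᶜ) ∩ (Eby ∩ Hbᶜ)) = μ.real (Ecy ∩ Eby) - (μ.real (Ecy ∩ Eby ∩ Hy) + μ.real (Ecy ∩ Eby ∩ Hb)) := by
    have e : (Ecy ∩ Hyᶜ) ∩ (Eby ∩ Hbᶜ) = (Ecy ∩ Eby) ∩ Hyᶜ ∩ Hbᶜ := by ext ω; simp only [Set.mem_inter_iff, Set.mem_compl_iff]; tauto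
    rw [e]; exact real_inter_compl₂ μ ms _ _ _ (fun ω hω => djBY ω hω.2)
  have lE2 : μ.real ((Eby ∩ Hbᶜ) ∩ (Ebc ∩ Hcᶜ)) = μ.real (Ebc ∩ Eby) - (μ.real (Ebc ∩ Eby ∩ Hc) + μ.real (Ebc ∩ Eby ∩ Hb)) := by
    have e : (Eby ∩ Hbᶜ) ∩ (Ebc ∩ Hcᶜ) = (Ebc ∩ Eby) ∩ Hcᶜ ∩ Hbᶜ := by ext ω; simp only [Set.mem_inter_iff, Set.mem_compl_iff]; tauto
    rw [e]; exact real_inter_compl₂ μ ms _ _ _ (fun ω hω => djBC ω hω.1)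
  have lC1 : μ.real ((Ebc ∩ Hcᶜ) ∩ (Ecy ∩ Hyᶜ) ∩ Eby) = μ.real (Ebc ∩ Ecy ∩ Eby) -
      (μ.real (Ebc ∩ Ecy ∩ Eby ∩ Hc) + μ.real (Ebc ∩ Ecy ∩ Eby ∩ Hy)) := by
    have e : (Ebc ∩ Hcᶜ) ∩ (Ecy ∩ Hyᶜ) ∩ Eby = (Ebc ∩ Ecy ∩ Eby) ∩ Hcᶜ ∩ Hyᶜ := by
      ext ω; simp only [Set.mem_inter_iff, Set.mem_compl_iff]; tauto
    rw [e]; exact real_inter_compl₂ μ ms _ _ _ (fun ω hω => djCY ω hω.1.2)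
  have lD1 : μ.real ((Ecy ∩ Hyᶜ) ∩ (Eby ∩ Hbᶜ) ∩ Ebc) = μ.real (Ebc ∩ Ecy ∩ Eby) -
      (μ.real (Ebc ∩ Ecy ∩ Eby ∩ Hy) + μ.real (Ebc ∩ Ecy ∩ Eby ∩ Hb)) := by
    have e : (Ecy ∩ Hyᶜ) ∩ (Eby ∩ Hbᶜ) ∩ Ebc = (Ebc ∩ Ecy ∩ Eby) ∩ Hyᶜ ∩ Hbᶜ := by
      ext ω; simp only [Set.mem_inter_iff, Set.mem_compl_iff]; tauto
    rw [e]; exact real_inter_compl₂ μ ms _ _ _ (fun ω hω => djBY ω hω.2)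
  have lE1 : μ.real ((Eby ∩ Hbᶜ) ∩ (Ebc ∩ Hcᶜ) ∩ Ecy) = μ.real (Ebc ∩ Ecy ∩ Eby) -
      (μ.real (Ebc ∩ Ecy ∩ Eby ∩ Hb) + μ.real (Ebc ∩ Ecy ∩ Eby ∩ Hc)) := by
    have e : (Eby ∩ Hbᶜ) ∩ (Ebc ∩ Hcᶜ) ∩ Ecy = (Ebc ∩ Ecy ∩ Eby) ∩ Hbᶜ ∩ Hcᶜ := by
      ext ω; simp only [Set.mem_inter_iff, Set.mem_compl_iff]; tauto
    rw [e]; exact real_inter_compl₂ μ ms _ _ _ (fun ω hω h1 h2 => djBC ω hω.1.1 h2 h1)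
  have lF1 : μ.real ((Ebc ∩ Hcᶜ) ∩ (Ecy ∩ Hyᶜ) ∩ (Eby ∩ Hbᶜ)) = μ.real (Ebc ∩ Ecy ∩ Eby) -
      (μ.real (Ebc ∩ Ecy ∩ Eby ∩ Hc) + μ.real (Ebc ∩ Ecy ∩ Eby ∩ Hy) + μ.real (Ebc ∩ Ecy ∩ Eby ∩ Hb)) := by
    have e : (Ebc ∩ Hcᶜ) ∩ (Ecy ∩ Hyᶜ) ∩ (Eby ∩ Hbᶜ) = (Ebc ∩ Ecy ∩ Eby) ∩ Hcᶜ ∩ Hyᶜ ∩ Hbᶜ := by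
      ext ω; simp only [Set.mem_inter_iff, Set.mem_compl_iff]; tauto
    rw [e]; exact real_inter_compl₃ μ ms _ _ _ _ (fun ω hω => djCY ω hω.1.2) (fun ω hω => djBC ω hω.1.1) (fun ω hω => djBY ω hω.2)
  -- normalise the orders of intersections appearing in the hypotheses
  have s1 : μ.real (Eby ∩ Ecy) = μ.real (Ecy ∩ Eby) := by rw [Set.inter_comm]
  have s1' : μ.real (Ecy ∩ Ebc) = μ.real (Ebc ∩ Ecy) := by rw [Set.inter_comm]
  have s2 : μ.real (Ebc ∩ Eby ∩ Ecy) = μ.real (Ebc ∩ Ecy ∩ Eby) := by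
    congr 1; ext ω; simp only [Set.mem_inter_iff]; tauto
  rw [s1] at h43 h19a
  rw [s2] at h43
  rw [s1'] at h19c
  have s3 : μ.real ((Ebc ∩ Hcᶜ) ∩ (Eby ∩ Hbᶜ)) = μ.real ((Eby ∩ Hbᶜ) ∩ (Ebc ∩ Hcᶜ)) := by rw [Set.inter_comm]
  rw [s3] at h37
  have hρ0 : 0 ≤ μ.real EA := measureReal_nonneg
  have hρ1 : μ.real EA ≤ 1 := (measureReal_mono (Set.subset_univ EA)).trans (le_of_eq (by simp [hμ]))
  rw [sahiE3_def, eXYZ, eX, eY, eZ, eYZ, eXZ, eXY]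
  exact row37_threeOneCutA_ineq (μ.real EA) (μ.real Ebc) (μ.real Ecy) (μ.real Eby) (μ.real (Ebc ∩ Hc)) (μ.real (Ecy ∩ Hy))
    (μ.real (Eby ∩ Hb)) (μ.real (Ebc ∩ Ecy)) (μ.real (Ebc ∩ Eby)) (μ.real (Ecy ∩ Eby)) (μ.real (Ebc ∩ Ecy ∩ Eby))
    (μ.real (Ebc ∩ Ecy ∩ Hc)) (μ.real (Ebc ∩ Ecy ∩ Hy)) (μ.real (Ebc ∩ Eby ∩ Hc)) (μ.real (Ebc ∩ Eby ∩ Hb))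
    (μ.real (Ecy ∩ Eby ∩ Hy)) (μ.real (Ecy ∩ Eby ∩ Hb)) (μ.real (Ebc ∩ Ecy ∩ Eby ∩ Hc)) (μ.real (Ebc ∩ Ecy ∩ Eby ∩ Hy))
    (μ.real (Ebc ∩ Ecy ∩ Eby ∩ Hb)) _ _ _ _ _ _ _ _ _ _ _ _ _ _ _ _ _ _ _ hρ0 hρ1
    lA1 lA2 lA3 lA4 lB1 lB2 lB3 lB4 lG1 lG2 lG3 lG4 lC1 lC2 lD1 lD2 lE1 lE2 lF1 h43 h19a h19b h19c h15a h15b h15c h37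

end Summit.CriticalPhenomena.PercolationContinuityZ3.Theorems.FrontierDecRows
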